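import Mathlib
import Literature.Analysis.FluidPDE.SuitableWeak
import Summits.NavierStokesRegularity.NavierStokesRegularity.Theses.EulerZoomLiouville
import Summits.NavierStokesRegularity.NavierStokesRegularity.Theorems.EulerZoomLiouvillePowerGaugeEulerLiouvilleSpacePeriodic
import HarnessLib

/-!
# The SCREW-SYMMETRIC (helical) stratum of the crux `EulerZoomLiouville.PowerGaugeEulerLiouville`
# (route №10 `EulerZoomLiouville`, item stmt-NavierStokesRegularity-19832) — every `ρ > 0`

Helper file (theorems only; `--supports stmt-NavierStokesRegularity-19832`, line `birth`, a stratum of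
STUB 3 `stub_noCollapseFromZero`). Seat ns-typeII-p3 (cell ns-regularity-ideate §B, D-0081).

THE STRATUM. Let `(u, p)` be an ancient local-energy Euler flow on `(−∞,0) × ℝ³` in Seregin's
power-gauged class with exponent `ρ > 0` and suppose every slice is SCREW-SYMMETRIC in norm:
`|u(τ, L(y − y₀) + y₀ + w)| = |u(τ, y)|` for all `τ < 0` and `y ∈ ℝ³`, where `L` is a linear isometry of
`ℝ³` fixing the nonzero vector `w` (`L w = w`) and `y₀` is any base point — i.e. `u` is invariant (up
to a norm-preserving action on its values) under the screw motion `y ↦ L(y − y₀) + y₀ + w` with axis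
`y₀ + ℝw` and nonzero pitch `|w|`.  Then `u = 0` a.e. on the slab —
`powerGaugeEulerLiouville_screwSymmetric`.  With `L = id` this is the spatially periodic stratum of
`Theorems/EulerZoomLiouvillePowerGaugeEulerLiouvilleSpacePeriodic.lean` (now at any base point); with `L`
a rotation about `ℝw` it covers all HELICALLY SYMMETRIC members of nonzero pitch (the classical
helical Euler flows, with or without helical swirl, when ancient and in the class).  Like rungs A/B and
the periodic strata this is a FLOOR label (critic-2's K-READ 01 §K5): only the ARITHMETIC of the
`A`-weight is used — the orbit balls `B(y₀ + k w, R)` carry equal slice mass (`setLIntegral_ball_screw`: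
rotations preserve Lebesgue measure, `L(kw) = kw`), are pairwise disjoint once `|w| ≥ 2R` (replace `w` by
a multiple — the symmetry iterates), and lie in `B(0, |y₀| + n|w| + R)`, so the `A`-gauge bound
`∫_{B_a}|u(τ)|² ≤ c a^{1−2ρ}` (`slice_ball_le_of_gaugeA`) gives `n · I ≤ c (nL)^{1−2ρ}`, `I → 0`.
No Euler system, no pressure, no `E`-gauge, no local energy inequality.
`screwSymmetric_of_powerGaugeEulerLiouville` records that the stratum is a literal sub-case of the route decl.

WHAT THIS IS NOT: not NS, not the crux (OPEN on `0 < ρ ≤ 1/2` for genuinely three-dimensional,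
non-symmetric, transient members). [folklore]
-/

noncomputable section

-- the summit and its single problem share the name `NavierStokesRegularity` (D-0017 nested layout)
set_option linter.dupNamespace false

open Set Function Filter Topology MeasureTheory Metric TopologicalSpace
open scoped NNReal ENNReal InnerProductSpace RealInnerProductSpace

namespace Summit.NavierStokesRegularity.NavierStokesRegularity.Theorems.PowerGaugeEulerLiouville.ScrewSymmetric

open Literature.Analysis Literature.Analysis.FluidPDE
open Summit.NavierStokesRegularity.NavierStokesRegularity.Theorems.PowerGaugeEulerLiouville.SpacePeriodic

/-! ## (1) Rotations preserve ball integrals; the orbit balls carry equal mass -/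

/-- **A linear isometry preserves integrals over centred balls**: `∫_{B(0,R)} f(L x) dx = ∫_{B(0,R)} f`.
[folklore] -/
theorem setLIntegral_ball_comp_linearIsometryEquiv
    (L : EuclideanSpace ℝ (Fin 3) ≃ₗᵢ[ℝ] EuclideanSpace ℝ (Fin 3)) (f : EuclideanSpace ℝ (Fin 3) → ℝ≥0∞) (R : ℝ) :
    ∫⁻ x in ball (0 : EuclideanSpace ℝ (Fin 3)) R, f (L x) = ∫⁻ x in ball (0 : EuclideanSpace ℝ (Fin 3)) R, f x := by
  have hpre : (⇑L) ⁻¹' ball (0 : EuclideanSpace ℝ (Fin 3)) R = ball (0 : EuclideanSpace ℝ (Fin 3)) R := by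
    ext x
    simp
  have h := L.measurePreserving.setLIntegral_comp_preimage_emb L.toHomeomorph.measurableEmbedding f
    (ball (0 : EuclideanSpace ℝ (Fin 3)) R)
  rw [hpre] at h
  exact h

/-- **The orbit balls of a screw-symmetric density carry equal mass.**  If
`g(L(y − y₀) + y₀ + w) = g(y)` for all `y`, with `L` a linear isometry fixing `w`, then
`∫_{B(y₀ + k w, R)} g = ∫_{B(y₀, R)} g` for every `k ∈ ℕ`. [folklore] -/
theorem setLIntegral_ball_screw (g : EuclideanSpace ℝ (Fin 3) → ℝ≥0∞)
    (L : EuclideanSpace ℝ (Fin 3) ≃ₗᵢ[ℝ] EuclideanSpace ℝ (Fin 3)) {y₀ w : EuclideanSpace ℝ (Fin 3)}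
    (hLw : L w = w) (hsym : ∀ y, g (L (y - y₀) + y₀ + w) = g y) (R : ℝ) (k : ℕ) :
    ∫⁻ x in ball (y₀ + (k : ℝ) • w) R, g x = ∫⁻ x in ball y₀ R, g x := by
  induction k with
  | zero => simp
  | succ k ih =>
    -- translate both balls to the origin
    rw [setLIntegral_ball_translate g (y₀ + (((k + 1 : ℕ) : ℝ)) • w) R]
    rw [setLIntegral_ball_translate g (y₀ + (k : ℝ) • w) R] at ih
    rw [← ih, ← setLIntegral_ball_comp_linearIsometryEquiv L (fun x => g (x + (y₀ + (((k + 1 : ℕ) : ℝ)) • w))) R]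
    refine setLIntegral_congr_fun measurableSet_ball (fun x _ => ?_)
    -- `L x + y₀ + (k+1) w = L((x + y₀ + k w) − y₀) + y₀ + w`
    have hLk : L ((k : ℝ) • w) = (k : ℝ) • w := by rw [L.map_smul, hLw]
    have key : L x + (y₀ + (((k + 1 : ℕ) : ℝ)) • w) = L ((x + (y₀ + (k : ℝ) • w)) - y₀) + y₀ + w := by
      rw [show x + (y₀ + (k : ℝ) • w) - y₀ = x + (k : ℝ) • w by abel, L.map_add, hLk]
      push_cast
      rw [add_smul, one_smul]
      abel
    show g (L x + (y₀ + (((k + 1 : ℕ) : ℝ)) • w)) = g (x + (y₀ + (k : ℝ) • w))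
    rw [key, hsym]

/-! ## (2) Packing the orbit balls -/

/-- **`n` disjoint orbit balls carry `n` times the mass**: if all the balls `B(y₀ + k w, R)` carry the
mass of `B(y₀, R)` and `|w| ≥ 2R`, then `n · ∫_{B(y₀,R)} g ≤ ∫_{⋃_{k<n} B(y₀ + k w, R)} g`. [folklore] -/
theorem mul_orbitBall_le (g : EuclideanSpace ℝ (Fin 3) → ℝ≥0∞) {y₀ w : EuclideanSpace ℝ (Fin 3)} {R : ℝ}
    (hmass : ∀ k : ℕ, ∫⁻ x in ball (y₀ + (k : ℝ) • w) R, g x = ∫⁻ x in ball y₀ R, g x)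
    (hw : 2 * R ≤ ‖w‖) (n : ℕ) :
    (n : ℝ≥0∞) * ∫⁻ x in ball y₀ R, g x ≤
      ∫⁻ x in ⋃ k ∈ Finset.range n, ball (y₀ + (k : ℝ) • w) R, g x := by
  induction n with
  | zero => simp
  | succ n ih =>
    have hdisj : Disjoint (⋃ k ∈ Finset.range n, ball (y₀ + (k : ℝ) • w) R) (ball (y₀ + (n : ℝ) • w) R) := by
      refine disjoint_iUnion₂_left.2 fun k hk => ?_
      have hk' : (k : ℝ) + 1 ≤ n := by exact_mod_cast Finset.mem_range.1 hk
      refine ball_disjoint_ball ?_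
      rw [dist_eq_norm, show y₀ + (k : ℝ) • w - (y₀ + (n : ℝ) • w) = ((k : ℝ) - n) • w by rw [sub_smul]; abel,
        norm_smul, Real.norm_eq_abs, abs_sub_comm, abs_of_nonneg (by linarith)]
      nlinarith [norm_nonneg w]
    rw [Finset.range_add_one, Finset.set_biUnion_insert, union_comm,
      lintegral_union measurableSet_ball hdisj, hmass n]
    calc (((n + 1 : ℕ) : ℝ≥0∞)) * ∫⁻ x in ball y₀ R, g x
        = (n : ℝ≥0∞) * (∫⁻ x in ball y₀ R, g x) + ∫⁻ x in ball y₀ R, g x := by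
          push_cast; ring
      _ ≤ (∫⁻ x in ⋃ k ∈ Finset.range n, ball (y₀ + (k : ℝ) • w) R, g x) + ∫⁻ x in ball y₀ R, g x :=
          add_le_add ih le_rfl

/-- The first `n` orbit balls lie in the ball `B(0, |y₀| + n|w| + R)`. [folklore] -/
theorem iUnion_orbitBall_subset {y₀ w : EuclideanSpace ℝ (Fin 3)} {R : ℝ} (n : ℕ) :
    (⋃ k ∈ Finset.range n, ball (y₀ + (k : ℝ) • w) R) ⊆
      ball (0 : EuclideanSpace ℝ (Fin 3)) (‖y₀‖ + (n : ℝ) * ‖w‖ + R) := by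
  refine iUnion₂_subset fun k hk => ?_
  have hk' : (k : ℝ) + 1 ≤ n := by exact_mod_cast Finset.mem_range.1 hk
  intro x hx
  rw [mem_ball_zero_iff]
  rw [mem_ball, dist_eq_norm] at hx
  calc ‖x‖ = ‖(x - (y₀ + (k : ℝ) • w)) + (y₀ + (k : ℝ) • w)‖ := by rw [sub_add_cancel]
    _ ≤ ‖x - (y₀ + (k : ℝ) • w)‖ + ‖y₀ + (k : ℝ) • w‖ := norm_add_le _ _
    _ ≤ ‖x - (y₀ + (k : ℝ) • w)‖ + (‖y₀‖ + ‖(k : ℝ) • w‖) := add_le_add le_rfl (norm_add_le _ _)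
    _ < R + (‖y₀‖ + (k : ℝ) * ‖w‖) := by
        rw [norm_smul, Real.norm_eq_abs, abs_of_nonneg (by positivity)]
        linarith
    _ ≤ ‖y₀‖ + (n : ℝ) * ‖w‖ + R := by nlinarith [norm_nonneg w]

/-! ## (3) Every slice of a screw-symmetric member vanishes on every ball -/

/-- Iterating the screw symmetry: invariance under `y ↦ L^m(y − y₀) + y₀ + m w` in the form needed —
the density `|u(τ)|²` is invariant under the screw motion with the multiplied pitch `m w` and the
rotation `L^m`; we only record the consequence on the orbit balls `B(y₀ + k (m w), R)`. [folklore] -/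
theorem orbitBall_mass_eq_of_screw {u : ℝ → EuclideanSpace ℝ (Fin 3) → EuclideanSpace ℝ (Fin 3)}
    (L : EuclideanSpace ℝ (Fin 3) ≃ₗᵢ[ℝ] EuclideanSpace ℝ (Fin 3)) {y₀ w : EuclideanSpace ℝ (Fin 3)}
    (hLw : L w = w) {τ : ℝ} (hsym : ∀ y, ‖u τ (L (y - y₀) + y₀ + w)‖ = ‖u τ y‖) (R : ℝ) (m k : ℕ) :
    ∫⁻ x in ball (y₀ + (k : ℝ) • ((m : ℝ) • w)) R, ‖u τ x‖ₑ ^ 2 =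
      ∫⁻ x in ball y₀ R, ‖u τ x‖ₑ ^ 2 := by
  have h := setLIntegral_ball_screw (fun x => ‖u τ x‖ₑ ^ 2) L hLw (fun y => by
    show ‖u τ (L (y - y₀) + y₀ + w)‖ₑ ^ 2 = ‖u τ y‖ₑ ^ 2
    rw [← ofReal_norm, ← ofReal_norm, hsym]) R (k * m)
  rw [← h]
  congr 2
  push_cast
  rw [smul_smul, mul_comm]

/-- **Slices of a screw-symmetric member vanish**: if `|u(τ, L(y−y₀)+y₀+w)| = |u(τ, y)|` (`L w = w`,
`w ≠ 0`) for some `τ < 0` and `a^{2ρ} A(u; Q_a(0)) ≤ c` for all `a > 0` (`ρ > 0`), then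
`∫_{B(y₀,R)} |u(τ)|² = 0` for every `R > 0`: with the pitch multiplied to `|m w| ≥ 2R` and
`a = nK`, `K = |y₀| + |m w| + R + √(−τ) + 1`, packing and the `A`-gauge give `n · I ≤ c (nK)^{1−2ρ}`,
i.e. `I ≤ c K^{1−2ρ} n^{−2ρ} → 0`. [folklore] -/
theorem slice_ball_eq_zero_of_screw {ρ : ℝ} (hρ : 0 < ρ)
    {u : ℝ → EuclideanSpace ℝ (Fin 3) → EuclideanSpace ℝ (Fin 3)} {c : ℝ≥0}
    (hA : ∀ a : ℝ, 0 < a →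
      ENNReal.ofReal (a ^ (2 * ρ)) * cknA a (0 : ℝ × EuclideanSpace ℝ (Fin 3)) u ≤ (c : ℝ≥0∞))
    (L : EuclideanSpace ℝ (Fin 3) ≃ₗᵢ[ℝ] EuclideanSpace ℝ (Fin 3)) {y₀ w : EuclideanSpace ℝ (Fin 3)}
    (hw : w ≠ 0) (hLw : L w = w) {τ : ℝ} (hτ : τ < 0)
    (hsym : ∀ y, ‖u τ (L (y - y₀) + y₀ + w)‖ = ‖u τ y‖) {R : ℝ} (hR : 0 < R) :
    ∫⁻ x in ball y₀ R, ‖u τ x‖ₑ ^ 2 = 0 := by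
  set g : EuclideanSpace ℝ (Fin 3) → ℝ≥0∞ := fun x => ‖u τ x‖ₑ ^ 2 with hg
  set I : ℝ≥0∞ := ∫⁻ x in ball y₀ R, g x with hI
  -- a pitch multiple `W = m w` with `‖W‖ ≥ 2R`
  have hwpos : 0 < ‖w‖ := norm_pos_iff.2 hw
  obtain ⟨m, hm⟩ := exists_nat_gt (2 * R / ‖w‖)
  set W : EuclideanSpace ℝ (Fin 3) := (m : ℝ) • w with hW
  have hWnorm : 2 * R ≤ ‖W‖ := by
    rw [hW, norm_smul, Real.norm_eq_abs, abs_of_nonneg (by positivity)]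
    rw [div_lt_iff₀ hwpos] at hm
    linarith
  have hmass : ∀ k : ℕ, ∫⁻ x in ball (y₀ + (k : ℝ) • W) R, g x = ∫⁻ x in ball y₀ R, g x :=
    fun k => orbitBall_mass_eq_of_screw L hLw hsym R m k
  -- the scale `K` and the bound `I ≤ c K^{1-2ρ} n^{-2ρ}` for `n ≥ 1`
  set K : ℝ := ‖y₀‖ + ‖W‖ + R + Real.sqrt (-τ) + 1 with hK
  have hK1 : 1 ≤ K := by
    have := norm_nonneg W
    have := norm_nonneg y₀
    have := Real.sqrt_nonneg (-τ)
    linarith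
  have hK0 : 0 < K := by linarith
  have key : ∀ n : ℕ, 1 ≤ n → I ≤ ENNReal.ofReal ((c : ℝ) * K ^ (1 - 2 * ρ) * (n : ℝ) ^ (-(2 * ρ))) := by
    intro n hn
    have hn' : (1 : ℝ) ≤ n := by exact_mod_cast hn
    have hn0 : (0 : ℝ) < n := by linarith
    set a : ℝ := (n : ℝ) * K with ha
    have ha0 : 0 < a := mul_pos hn0 hK0
    have haK : K ≤ a := by rw [ha]; nlinarith
    have hτa : -(a ^ 2) < τ := by
      have h1 : Real.sqrt (-τ) ^ 2 = -τ := Real.sq_sqrt (by linarith)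
      have h2 : Real.sqrt (-τ) < a := by
        have := norm_nonneg W
        have := norm_nonneg y₀
        linarith
      nlinarith [Real.sqrt_nonneg (-τ)]
    have hsub : (⋃ k ∈ Finset.range n, ball (y₀ + (k : ℝ) • W) R) ⊆ ball (0 : EuclideanSpace ℝ (Fin 3)) a := by
      refine (iUnion_orbitBall_subset n).trans (ball_subset_ball ?_)
      rw [ha, hK]
      have := Real.sqrt_nonneg (-τ)
      have := norm_nonneg y₀
      nlinarith [norm_nonneg W]
    have h1 : (n : ℝ≥0∞) * I ≤ ENNReal.ofReal ((c : ℝ) * a ^ (1 - 2 * ρ)) :=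
      calc (n : ℝ≥0∞) * I ≤ ∫⁻ x in ⋃ k ∈ Finset.range n, ball (y₀ + (k : ℝ) • W) R, g x :=
            mul_orbitBall_le g hmass hWnorm n
        _ ≤ ∫⁻ x in ball (0 : EuclideanSpace ℝ (Fin 3)) a, g x := lintegral_mono_set hsub
        _ ≤ ENNReal.ofReal ((c : ℝ) * a ^ (1 - 2 * ρ)) := slice_ball_le_of_gaugeA ha0 hτa hτ (hA a ha0)
    have hn0' : (n : ℝ≥0∞) ≠ 0 := by exact_mod_cast (show (n : ℕ) ≠ 0 by exact_mod_cast hn0.ne')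
    have h2 : I ≤ ENNReal.ofReal ((c : ℝ) * a ^ (1 - 2 * ρ)) / (n : ℝ≥0∞) := by
      rw [ENNReal.le_div_iff_mul_le (Or.inl hn0') (Or.inl (ENNReal.natCast_ne_top n)), mul_comm]
      exact h1
    refine h2.trans (le_of_eq ?_)
    rw [← ENNReal.ofReal_natCast, ← ENNReal.ofReal_div_of_pos hn0]
    congr 1
    rw [ha, Real.mul_rpow hn0.le hK0.le, Real.rpow_sub hn0, Real.rpow_one, Real.rpow_neg hn0.le]
    field_simp
  have hlim : Tendsto (fun n : ℕ => ENNReal.ofReal ((c : ℝ) * K ^ (1 - 2 * ρ) * (n : ℝ) ^ (-(2 * ρ))))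
      atTop (𝓝 0) := by
    have h1 : Tendsto (fun n : ℕ => ((n : ℝ)) ^ (-(2 * ρ))) atTop (𝓝 0) :=
      (tendsto_rpow_neg_atTop (by linarith : 0 < 2 * ρ)).comp tendsto_natCast_atTop_atTop
    have h2 := h1.const_mul ((c : ℝ) * K ^ (1 - 2 * ρ))
    rw [mul_zero] at h2
    have h3 := ENNReal.tendsto_ofReal h2
    rwa [ENNReal.ofReal_zero] at h3
  have hev : ∀ᶠ n : ℕ in atTop, I ≤ ENNReal.ofReal ((c : ℝ) * K ^ (1 - 2 * ρ) * (n : ℝ) ^ (-(2 * ρ))) :=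
    (eventually_ge_atTop 1).mono fun n hn => key n hn
  exact le_antisymm (le_of_tendsto_of_tendsto tendsto_const_nhds hlim hev) bot_le

/-! ## (4) The stratum -/

/-- **The SCREW-SYMMETRIC (helical) stratum of `EulerZoomLiouville.PowerGaugeEulerLiouville`, every
`ρ > 0`.**  An ancient local-energy Euler flow `(u, p)` on `(−∞, 0) × ℝ³` (suitable weak, `ν = 0`,
`f = 0`, weak spatial gradient `H`) in Seregin's power-gauged class whose slices obey
`|u(τ, L(y − y₀) + y₀ + w)| = |u(τ, y)|` (`L` a linear isometry with `L w = w`, `w ≠ 0`, `y₀` any base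
point: helical symmetry of nonzero pitch about the axis `y₀ + ℝw`; `L = id`: spatial periodicity)
vanishes a.e. on the slab.  Only the `A`-gauge is used (`slice_ball_eq_zero_of_screw` for every slice
and every ball `B(y₀, R)`, which exhaust `ℝ³`; then Tonelli on boxes exhausting the slab). [folklore] -/
theorem powerGaugeEulerLiouville_screwSymmetric :
    ∀ ρ : ℝ, 0 < ρ → ∀ (u : ℝ → EuclideanSpace ℝ (Fin 3) → EuclideanSpace ℝ (Fin 3))
      (p : ℝ → EuclideanSpace ℝ (Fin 3) → ℝ)
      (H : ℝ → EuclideanSpace ℝ (Fin 3) → EuclideanSpace ℝ (Fin 3) →L[ℝ] EuclideanSpace ℝ (Fin 3))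
      (c : NNReal) (L : EuclideanSpace ℝ (Fin 3) ≃ₗᵢ[ℝ] EuclideanSpace ℝ (Fin 3)) (y₀ w : EuclideanSpace ℝ (Fin 3)),
      w ≠ 0 → L w = w →
      (∀ τ : ℝ, τ < 0 → ∀ y : EuclideanSpace ℝ (Fin 3), ‖u τ (L (y - y₀) + y₀ + w)‖ = ‖u τ y‖) →
      Literature.Analysis.FluidPDE.IsSuitableWeakSolutionOn
          (Literature.Analysis.FluidPDE.slab (EuclideanSpace ℝ (Fin 3)) (Set.Iio 0) isOpen_Iio) 0 0 u p →
      Literature.Analysis.FluidPDE.HasWeakSpatialGradientOn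
          (Literature.Analysis.FluidPDE.slab (EuclideanSpace ℝ (Fin 3)) (Set.Iio 0) isOpen_Iio) u H →
      (∀ a : ℝ, 0 < a →
        ENNReal.ofReal (a ^ (2 * ρ)) *
            Literature.Analysis.FluidPDE.cknA a (0 : ℝ × EuclideanSpace ℝ (Fin 3)) u +
          ENNReal.ofReal (a ^ ρ) *
            Literature.Analysis.FluidPDE.cknE a (0 : ℝ × EuclideanSpace ℝ (Fin 3)) H +
          ENNReal.ofReal (a ^ (2 * ρ)) *
            Literature.Analysis.FluidPDE.cknD a (0 : ℝ × EuclideanSpace ℝ (Fin 3)) p ≤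
          (c : ENNReal)) →
      Function.uncurry u =ᵐ[volume.restrict
        (Set.Iio (0 : ℝ) ×ˢ (Set.univ : Set (EuclideanSpace ℝ (Fin 3))))] 0 := by
  intro ρ hρ u p H c L y₀ w hw hLw hsym _hsw hH hc
  have hA : ∀ a : ℝ, 0 < a → ENNReal.ofReal (a ^ (2 * ρ)) *
      cknA a (0 : ℝ × EuclideanSpace ℝ (Fin 3)) u ≤ (c : ℝ≥0∞) :=
    fun a ha => le_trans (le_trans le_self_add le_self_add) (hc a ha)
  set f : ℝ × EuclideanSpace ℝ (Fin 3) → ℝ≥0∞ := fun z => ‖u z.1 z.2‖ₑ ^ 2 with hf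
  have hmeas : AEStronglyMeasurable (uncurry u)
      (volume.restrict (Iio (0 : ℝ) ×ˢ (univ : Set (EuclideanSpace ℝ (Fin 3))))) := by
    have := hH.locallyIntegrableOn.aestronglyMeasurable
    simpa [slab] using this
  have hfm : AEMeasurable f (volume.restrict (Iio (0 : ℝ) ×ˢ (univ : Set (EuclideanSpace ℝ (Fin 3))))) :=
    hmeas.enorm.pow_const 2
  -- on each box `(−N−1, 0) × B(y₀, N+1)` the mass of `|u|²` vanishes (Tonelli + every slice vanishes)
  have hbox : ∀ N : ℕ, ∀ᵐ z ∂(volume.restrict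
      (Ioo (-((N : ℝ) + 1)) 0 ×ˢ ball y₀ ((N : ℝ) + 1))), f z = 0 := by
    intro N
    have hsub : Ioo (-((N : ℝ) + 1)) 0 ×ˢ ball y₀ ((N : ℝ) + 1) ⊆
        Iio (0 : ℝ) ×ˢ (univ : Set (EuclideanSpace ℝ (Fin 3))) :=
      prod_mono (fun τ hτ => hτ.2) (subset_univ _)
    have hfm' : AEMeasurable f (volume.restrict (Ioo (-((N : ℝ) + 1)) 0 ×ˢ ball y₀ ((N : ℝ) + 1))) :=
      hfm.mono_set hsub
    refine (lintegral_eq_zero_iff' hfm').1 ?_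
    have hμ : (volume : Measure (ℝ × EuclideanSpace ℝ (Fin 3))).restrict
        (Ioo (-((N : ℝ) + 1)) 0 ×ˢ ball y₀ ((N : ℝ) + 1)) =
        (volume.restrict (Ioo (-((N : ℝ) + 1)) 0)).prod (volume.restrict (ball y₀ ((N : ℝ) + 1))) := by
      rw [Measure.volume_eq_prod, Measure.prod_restrict]
    rw [hμ] at hfm' ⊢
    rw [lintegral_prod f hfm']
    refine (setLIntegral_congr_fun measurableSet_Ioo (fun τ hτ => ?_)).trans (lintegral_zero)
    exact slice_ball_eq_zero_of_screw hρ hA L hw hLw hτ.2 (hsym τ hτ.2) (by positivity)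
  -- the boxes exhaust the slab
  have hU : (Iio (0 : ℝ) ×ˢ (univ : Set (EuclideanSpace ℝ (Fin 3)))) =
      ⋃ N : ℕ, (Ioo (-((N : ℝ) + 1)) 0 ×ˢ ball y₀ ((N : ℝ) + 1)) := by
    ext z
    simp only [mem_prod, mem_Iio, mem_univ, and_true, mem_iUnion, mem_Ioo, mem_ball]
    constructor
    · intro hz
      obtain ⟨N, hN⟩ := exists_nat_gt (max (-z.1) (dist z.2 y₀))
      exact ⟨N, ⟨by linarith [le_max_left (-z.1) (dist z.2 y₀)], hz⟩,
        by linarith [le_max_right (-z.1) (dist z.2 y₀)]⟩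
    · rintro ⟨N, ⟨-, h2⟩, -⟩
      exact h2
  have hall : ∀ᵐ z ∂(volume.restrict (Iio (0 : ℝ) ×ˢ (univ : Set (EuclideanSpace ℝ (Fin 3))))),
      f z = 0 := by
    rw [hU, ae_restrict_iUnion_iff]
    exact hbox
  filter_upwards [hall] with z hz
  have h1 : ‖u z.1 z.2‖ₑ = 0 := by simpa [hf] using hz
  simpa [uncurry] using h1

/-- **The screw-symmetric stratum is a literal sub-case of the crux**
`E = EulerZoomLiouville.PowerGaugeEulerLiouville` (stmt-NavierStokesRegularity-19832). [folklore] -/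
theorem screwSymmetric_of_powerGaugeEulerLiouville
    (hE : Summit.NavierStokesRegularity.NavierStokesRegularity.Theses.EulerZoomLiouville.PowerGaugeEulerLiouville) :
    ∀ ρ : ℝ, 0 < ρ → ∀ (u : ℝ → EuclideanSpace ℝ (Fin 3) → EuclideanSpace ℝ (Fin 3))
      (p : ℝ → EuclideanSpace ℝ (Fin 3) → ℝ)
      (H : ℝ → EuclideanSpace ℝ (Fin 3) → EuclideanSpace ℝ (Fin 3) →L[ℝ] EuclideanSpace ℝ (Fin 3))
      (c : NNReal) (L : EuclideanSpace ℝ (Fin 3) ≃ₗᵢ[ℝ] EuclideanSpace ℝ (Fin 3)) (y₀ w : EuclideanSpace ℝ (Fin 3)),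
      w ≠ 0 → L w = w →
      (∀ τ : ℝ, τ < 0 → ∀ y : EuclideanSpace ℝ (Fin 3), ‖u τ (L (y - y₀) + y₀ + w)‖ = ‖u τ y‖) →
      Literature.Analysis.FluidPDE.IsSuitableWeakSolutionOn
          (Literature.Analysis.FluidPDE.slab (EuclideanSpace ℝ (Fin 3)) (Set.Iio 0) isOpen_Iio) 0 0 u p →
      Literature.Analysis.FluidPDE.HasWeakSpatialGradientOn
          (Literature.Analysis.FluidPDE.slab (EuclideanSpace ℝ (Fin 3)) (Set.Iio 0) isOpen_Iio) u H →
      (∀ a : ℝ, 0 < a →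
        ENNReal.ofReal (a ^ (2 * ρ)) *
            Literature.Analysis.FluidPDE.cknA a (0 : ℝ × EuclideanSpace ℝ (Fin 3)) u +
          ENNReal.ofReal (a ^ ρ) *
            Literature.Analysis.FluidPDE.cknE a (0 : ℝ × EuclideanSpace ℝ (Fin 3)) H +
          ENNReal.ofReal (a ^ (2 * ρ)) *
            Literature.Analysis.FluidPDE.cknD a (0 : ℝ × EuclideanSpace ℝ (Fin 3)) p ≤
          (c : ENNReal)) →
      Function.uncurry u =ᵐ[volume.restrict
        (Set.Iio (0 : ℝ) ×ˢ (Set.univ : Set (EuclideanSpace ℝ (Fin 3))))] 0 :=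
  fun ρ hρ u p H c _L _y₀ _w _hw _hLw _hsym hsw hH hc => hE ρ hρ u p H c hsw hH hc

end Summit.NavierStokesRegularity.NavierStokesRegularity.Theorems.PowerGaugeEulerLiouville.ScrewSymmetric

end
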